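import Mathlib.Topology.PartitionOfUnity
import HarnessLib

/-!
# Milnor's countable refinement by disjoint unions (every open cover of a paracompact space)

Topic `Literature/Topology`. J. Milnor, J. Stasheff, *Characteristic Classes* (1974), §5,
proof of Lemma 5.9 (a vector bundle over a paracompact base admits a countable trivialising cover;
also D. Husemoller, *Fibre Bundles*, 3rd ed. (1994), Ch. 3 Prop. 5.4 / proof of Thm. 5.5): given an
open cover `{U_α}` of a paracompact Hausdorff space `B`, choose a partition of unity `{φ_α}`
subordinate to it and, for every nonempty finite set `S` of indices, let
`W(S) = {b | φ_α(b) > φ_β(b) whenever α ∈ S, β ∉ S}`. Then each `W(S)` is open and contained in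
`U_α` for `α ∈ S`; `W(S) ∩ W(S') = ∅` if `S ≠ S'` have the same cardinality; and the `W(S)` cover
`B` (take `S` = the set of indices where `φ_α(b)` is maximal). Hence `W_k := ⋃_{|S| = k} W(S)`,
`k = 1, 2, …`, is a COUNTABLE open cover each member of which is a disjoint union of open sets
subordinate to the original cover — so anything "trivial over each `U_α`" and additive over
disjoint open unions is trivial over each `W_k`.

We prove this for an arbitrary open cover `U : ι → Set B` of a normal paracompact space
(`cellOfFinset`, `isOpen_cellOfFinset`, `cellOfFinset_subset`, `disjoint_cellOfFinset`,
`exists_mem_cellOfFinset`, and the packaged `exists_disjointed_nat_refinement`). Everything is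
proved; no named facts. Mathlib has partitions of unity (`PartitionOfUnity.exists_isSubordinate`,
used) but not this refinement (searched `PairwiseDisjoint` + `ParacompactSpace`, `countable` +
`refinement`).

## References

* [MilnorStasheffAMS76] J. Milnor, J. Stasheff, *Characteristic Classes*, Ann. of Math. Stud. 76
  (1974), §5, proof of Lemma 5.9.
* [HusemollerFibreBundles1994] D. Husemoller, *Fibre Bundles*, 3rd ed., GTM 20 (1994), Ch. 3 §5
  (proof of Thm. 5.5: countable trivialising covers over paracompact bases).
-/

noncomputable section

open Set Filter Topology Function

universe u v

namespace Literature.Topology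

variable {B : Type u} [TopologicalSpace B] {ι : Type v}

/-- **Milnor's cell `W(S)`** of a nonempty finite set of indices `S` for a partition of unity `φ`:
the points where every `φ_α`, `α ∈ S`, is positive and strictly exceeds every `φ_β`, `β ∉ S`
(Milnor–Stasheff §5, proof of Lemma 5.9). [cite: MilnorStasheffAMS76, §5 proof of Lemma 5.9] -/
def cellOfFinset (φ : PartitionOfUnity ι B) (S : Finset ι) : Set B :=
  {b | (∀ i ∈ S, 0 < φ i b) ∧ ∀ i ∈ S, ∀ j ∉ S, φ j b < φ i b}

/-- Membership in a cell. [folklore] -/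
theorem mem_cellOfFinset_iff (φ : PartitionOfUnity ι B) (S : Finset ι) (b : B) :
    b ∈ cellOfFinset φ S ↔ (∀ i ∈ S, 0 < φ i b) ∧ ∀ i ∈ S, ∀ j ∉ S, φ j b < φ i b :=
  Iff.rfl

/-- **`W(S) ⊆ U_α` for `α ∈ S`** when `φ` is subordinate to `U` (`φ_α > 0` on `W(S)`).
[cite: MilnorStasheffAMS76, §5 proof of Lemma 5.9] -/
theorem cellOfFinset_subset {φ : PartitionOfUnity ι B} {U : ι → Set B} (hφ : φ.IsSubordinate U)
    {S : Finset ι} {i : ι} (hi : i ∈ S) : cellOfFinset φ S ⊆ U i := fun _ hb ↦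
  hφ i (subset_tsupport _ (ne_of_gt (hb.1 i hi)))

/-- **Cells of distinct index sets of the same size are disjoint**: an index in `S ∖ S'` and one in
`S' ∖ S` would each have the strictly larger value. [cite: MilnorStasheffAMS76, §5 proof of Lemma 5.9] -/
theorem disjoint_cellOfFinset (φ : PartitionOfUnity ι B) {S T : Finset ι} (hcard : S.card = T.card)
    (hne : S ≠ T) : Disjoint (cellOfFinset φ S) (cellOfFinset φ T) := by
  classical
  rw [Set.disjoint_left]
  intro b hbS hbT
  -- neither set contains the other
  have hST : ¬ S ⊆ T := fun h ↦ hne (Finset.eq_of_subset_of_card_le h hcard.ge)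
  have hTS : ¬ T ⊆ S := fun h ↦ hne (Finset.eq_of_subset_of_card_le h hcard.le).symm
  obtain ⟨i, hiS, hiT⟩ := Finset.not_subset.1 hST
  obtain ⟨j, hjT, hjS⟩ := Finset.not_subset.1 hTS
  exact lt_asymm (hbS.2 i hiS j hjS) (hbT.2 j hjT i hiT)

/-- **Cells are open**: near a point only finitely many `φ_β` are nonzero (local finiteness), so
locally the defining condition is a finite conjunction of strict inequalities between continuous
functions. [cite: MilnorStasheffAMS76, §5 proof of Lemma 5.9] -/
theorem isOpen_cellOfFinset (φ : PartitionOfUnity ι B) (S : Finset ι) : IsOpen (cellOfFinset φ S) := by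
  classical
  rw [isOpen_iff_mem_nhds]
  intro b₀ hb₀
  -- a neighbourhood meeting only finitely many supports
  obtain ⟨N, hN, hfin⟩ := φ.locallyFinite b₀
  set T : Finset ι := hfin.toFinset with hT
  have hzero : ∀ b ∈ N, ∀ j ∉ T, φ j b = 0 := by
    intro b hb j hj
    by_contra h
    exact hj (hfin.mem_toFinset.2 ⟨b, Function.mem_support.2 h, hb⟩)
  -- the open set cut out by the finitely many relevant conditions
  set O : Set B := {b | ∀ i ∈ S, 0 < φ i b} ∩ {b | ∀ i ∈ S, ∀ j ∈ T, j ∉ S → φ j b < φ i b} with hO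
  have hOo : IsOpen O := by
    refine IsOpen.inter ?_ ?_
    · have : {b : B | ∀ i ∈ S, 0 < φ i b} = ⋂ i ∈ S, {b | 0 < φ i b} := by ext b; simp
      rw [this]
      exact isOpen_biInter_finset fun i _ ↦ isOpen_lt continuous_const (φ i).continuous
    · have : {b : B | ∀ i ∈ S, ∀ j ∈ T, j ∉ S → φ j b < φ i b} =
          ⋂ i ∈ S, ⋂ j ∈ T.filter (· ∉ S), {b | φ j b < φ i b} := by
        ext b
        simp only [mem_setOf_eq, mem_iInter, Finset.mem_filter, and_imp]
      rw [this]
      exact isOpen_biInter_finset fun i _ ↦ isOpen_biInter_finset fun j _ ↦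
        isOpen_lt (φ j).continuous (φ i).continuous
  have hb₀O : b₀ ∈ O := ⟨hb₀.1, fun i hi j _ hjS ↦ hb₀.2 i hi j hjS⟩
  -- on `N`, the cell is `O`
  have hsub : O ∩ N ⊆ cellOfFinset φ S := by
    rintro b ⟨⟨hpos, hlt⟩, hbN⟩
    refine ⟨hpos, fun i hi j hjS ↦ ?_⟩
    by_cases hjT : j ∈ T
    · exact hlt i hi j hjT hjS
    · rw [hzero b hbN j hjT]
      exact hpos i hi
  exact mem_of_superset (inter_mem (hOo.mem_nhds hb₀O) hN) hsub

/-- **The cells cover**: `b` lies in the cell of the (nonempty, finite) set of indices where `φ_α(b)`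
is maximal. [cite: MilnorStasheffAMS76, §5 proof of Lemma 5.9] -/
theorem exists_mem_cellOfFinset (φ : PartitionOfUnity ι B) (b : B) :
    ∃ S : Finset ι, S.Nonempty ∧ b ∈ cellOfFinset φ S := by
  classical
  -- the finitely many indices with `φ_α(b) ≠ 0`
  set F : Finset ι := φ.finsupport b with hF
  have hmemF : ∀ i, i ∈ F ↔ φ i b ≠ 0 := fun i ↦ by rw [hF, PartitionOfUnity.mem_finsupport]; rfl
  -- `F` is nonempty since `∑ φ_α(b) = 1`
  have hFne : F.Nonempty := by
    obtain ⟨i, hi⟩ := φ.exists_pos (mem_univ b)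
    exact ⟨i, (hmemF i).2 hi.ne'⟩
  -- the maximal value and the set where it is attained
  set M : ℝ := F.sup' hFne fun i ↦ φ i b with hM
  set S : Finset ι := F.filter fun i ↦ φ i b = M with hS
  obtain ⟨i₀, hi₀F, hi₀M⟩ := Finset.exists_mem_eq_sup' hFne fun i ↦ φ i b
  have hMpos : 0 < M := by
    rw [hM, hi₀M]
    exact lt_of_le_of_ne (φ.nonneg i₀ b) (Ne.symm ((hmemF i₀).1 hi₀F))
  refine ⟨S, ⟨i₀, Finset.mem_filter.2 ⟨hi₀F, hi₀M.symm ▸ rfl⟩⟩, ?_, ?_⟩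
  · intro i hi
    rw [(Finset.mem_filter.1 hi).2]
    exact hMpos
  · intro i hi j hj
    rw [(Finset.mem_filter.1 hi).2]
    by_cases hjF : j ∈ F
    · have hle : φ j b ≤ M := Finset.le_sup' (fun i ↦ φ i b) hjF
      have hneq : φ j b ≠ M := fun h ↦ hj (Finset.mem_filter.2 ⟨hjF, h⟩)
      exact lt_of_le_of_ne hle hneq
    · have : φ j b = 0 := by
        by_contra h
        exact hjF ((hmemF j).2 h)
      rw [this]
      exact hMpos

/-- **Milnor's refinement** (Milnor–Stasheff §5, proof of Lemma 5.9; Husemoller Ch. 3 §5): every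
open cover `U` of a normal paracompact space (e.g. paracompact Hausdorff) admits open sets `W(S)`,
indexed by the finite sets of indices, with `W(S) ⊆ U_α` for `α ∈ S`, `W(S) ∩ W(S') = ∅` for
`S ≠ S'` of the same cardinality, and every point in some `W(S)` with `S` nonempty. Consequently
`W_k = ⋃_{|S| = k} W(S)` (`k ≥ 1`) is a countable open cover by disjoint unions of sets subordinate
to `U`. [cite: MilnorStasheffAMS76, §5 proof of Lemma 5.9] [cite: HusemollerFibreBundles1994, Ch. 3 §5] -/
theorem exists_disjointed_nat_refinement [NormalSpace B] [ParacompactSpace B] (U : ι → Set B)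
    (hUo : ∀ i, IsOpen (U i)) (hU : ⋃ i, U i = univ) :
    ∃ W : Finset ι → Set B, (∀ S, IsOpen (W S)) ∧ (∀ S, ∀ i ∈ S, W S ⊆ U i) ∧
      (∀ S T, S.card = T.card → S ≠ T → Disjoint (W S) (W T)) ∧
      ∀ b, ∃ S : Finset ι, S.Nonempty ∧ b ∈ W S := by
  obtain ⟨φ, hφ⟩ := PartitionOfUnity.exists_isSubordinate isClosed_univ U hUo (by rw [hU])
  exact ⟨cellOfFinset φ, isOpen_cellOfFinset φ, fun S i hi ↦ cellOfFinset_subset hφ hi,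
    fun S T h hne ↦ disjoint_cellOfFinset φ h hne, exists_mem_cellOfFinset φ⟩

/-- The countable form: the open sets `W_k = ⋃_{|S| = k + 1} W(S)`, `k : ℕ`, cover the space, and
each is a union of PAIRWISE DISJOINT open sets each contained in some member of the cover.
[cite: MilnorStasheffAMS76, §5 proof of Lemma 5.9] -/
theorem exists_nat_cover_by_disjoint_subordinate [NormalSpace B] [ParacompactSpace B] (U : ι → Set B)
    (hUo : ∀ i, IsOpen (U i)) (hU : ⋃ i, U i = univ) :
    ∃ W : Finset ι → Set B, (∀ S, IsOpen (W S)) ∧ (∀ S, S.Nonempty → ∃ i, W S ⊆ U i) ∧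
      (∀ k : ℕ, ({S : Finset ι | S.card = k + 1}).PairwiseDisjoint W) ∧
      (⋃ k : ℕ, ⋃ S ∈ {S : Finset ι | S.card = k + 1}, W S) = univ := by
  obtain ⟨W, hWo, hWU, hdisj, hcov⟩ := exists_disjointed_nat_refinement U hUo hU
  refine ⟨W, hWo, fun S ⟨i, hi⟩ ↦ ⟨i, hWU S i hi⟩, fun k S hS T hT hne ↦ ?_, ?_⟩
  · exact hdisj S T (hS.trans hT.symm) hne
  · refine eq_univ_of_forall fun b ↦ ?_
    obtain ⟨S, hSne, hb⟩ := hcov b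
    refine mem_iUnion.2 ⟨S.card - 1, mem_iUnion₂.2 ⟨S, ?_, hb⟩⟩
    change S.card = S.card - 1 + 1
    have := hSne.card_pos
    omega

end Literature.Topology
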